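import Mathlib
import HarnessLib
import HarnessLib.Audit
import Summits.QuantumAdvantage.Statement
import Literature.Computability.Cryptography.SamplingProblems
import HarnessLib.Audit.Status.Attr

/-!
Route: CommutingDeciders

DORMANT since 2026-08-26T12:42:25Z (reconciler: no traction for 7.1 d (last activity item-proof-filed at 2026-08-19T10:05:29Z); parked, not closed — `ledger route dormant route-QuantumAdvantage-CommutingDeciders --off` to reactivate) — unstaffed, not closed; items shared with open routes are served there. `ledger route dormant <id> --off` reactivates.

# Route QuantumAdvantage/CommutingDeciders — "refresh without persistence" (idea card
refresh-without-persistence): a language outside BPP with a ONE-SHOT COMMUTING DECIDER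

## Thesis X (decl `CommutingWitness`)
Words: some language L ∉ BPP is decided with error ≤ 1/3 by a one-shot commuting decider: a
deterministic
poly-time map x ↦ D_x producing a diagonal circuit over the tree's IQP gate set iqpDiag = {Z, CZ, T}
on W_x
wires, ONE run of H^{⊗W} D_x H^{⊗W} on |0…0⟩ with every wire measured, and a poly-time verdict A(⟨x,
outcome⟩).
No gate is time-ordered (all commute), coherence lasts one layer, nothing quantum survives the call.
Lean (one line, elaborates; constants `Literature.Computability.Cryptography.{QCircuit, iqpDiag,
iqpUnitary,
QCircuit.sigmaEncode, basisState, QReg, BQP}`, `Literature.Computability.Complexity.{BPP, Classes.P,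
PolyTimeComputable, boolPair}`):
  ∃ L, L ∉ BPP ∧ ∃ (W : List Bool → ℕ) (D : ∀ x, QCircuit iqpDiag (W x)) (A : Language Bool), A ∈ P
∧
  PolyTimeComputable id sigmaEncode (x ↦ ⟨W x, 0, D x⟩) ∧ ∀ x, (x ∈ L → 2/3 ≤ Σ_w [boolPair x (ofFn
w) ∈ A]·‖(iqpUnitary (D x) |0⟩) w‖²) ∧ (x ∉ L → … ≤ 1/3).

## Relation to the card's X₂ = ¬(BPP^IQP ⊆ BPP)
One-shot deciders ⊆ BPP^IQP ⊆ BQP, so X ⟹ X₂ ⟹ QuantumAdvantage. Nothing in print is lost by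
dropping adaptivity:
every IQP decision algorithm known (BuzetChailloux2026 Thm 1: single-query IQP circuit for signed
2-Forrelation;
Thm 3 + Remark 2: (BPP^IQP)^O ⊄ PH^O with NON-ADAPTIVE calls) is non-adaptive, k non-adaptive IQP
calls are one
IQP call on disjoint registers (H^⊗(⊗D_i)H^⊗), and classical coins are free inside the call (an idle
wire with
S = T·T is a fair coin: |⟨1|HSH|0⟩|² = 1/2). The adaptive class BPP^IQP itself is requested as a
definition
(BPPSampIQP) and is deliberately not decomposed here.

## Assembly (decl `Assembly`)
`CommutingDecidersInBQP → CommutingWitness → QuantumAdvantage` — one line of logic once the bridge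
(support: one-shot commuting deciders decide only BQP languages; Z = S², CZ = (1⊗H)·CNOT·(1⊗H),
generator
x ↦ D_x compiled into a length-uniform Clifford+T family, verdict computed reversibly onto wire 0)
is proved.

Rationale: WHY THIS LINE. Quantum advantage with the clock removed: the weakest interference resource — one
commuting layer between two
Hadamard layers, fresh |0⟩'s, no persistent state — relativizes OUTSIDE PH (BuzetChailloux2026 Thms
1–3), yet white-box no candidate
language is known (ShepherdBremner2009 p.4: "unable to find any decision language in BPP^IQP that is
not in BPP"). Two tree facts frame
the white-box problem: (L) every F2-linear statistic of a {Z,CZ,T}-IQP output law is exactly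
computable (cubeFourierCoeff_iqpProb_eq_prod),
so a commuting decider's power lives in verdicts of large Fourier l1-mass (Z4-characters i^{|w|},
thresholds; cf. BC26 Thm 4, |F| = Ω(2^n));
(T) PostIQP ⊇ PostBQP for this very gate set (PostBQPWith_subset_PostIQPWith_holds), so ¬X needs
per-verdict dequantization, not wholesale
replacement of the sampler. Imported areas: harmonic analysis of digital sequences (Walsh spectra of
arithmetic progressions = carry
transfer matrices / 2-adic Riesz products; Gelfond1968, MauduitRivat2015) for A/B; Clifford+T
amplitude theory (BravyiGosset2016) for C.
STATE OF THE PERIOD-FINDING BRANCH (repair 2026-08-15). The law L_{m,r} of the Hadamard-measured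
Z-coset state — Shor's circuit with the
QFT replaced by H^{⊗m}, i.e. one standard phase-oracle query inside an IQP sandwich — is not
period-oblivious (TV(L_r, L_r') = 0.55–0.79
for random odd pairs, m = 8…14; ML recovers r from 16 samples at m ≤ 14), but EXACT identification
from poly(m) samples is REFUTED as
stated (refuter attack on stmt-2640, EVIDENCE.md: the twin periods r∓ = 3·2^a ∓ 1, m = 2a+4, satisfy
TV(L_{r−}, L_{r+}) ≤ C·0.9743^a by a
Walsh expansion + 2-adic compression T = 9X+3Y+Z + a doubled carry transfer matrix reduced to an
exact 16×16 rational matrix, certificate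
‖K^9‖_∞ < 1; numerically 1 − BC = 0.50·2^{−a/2} to m = 23; Le Cam then forces n ≥ c·1.026^a
samples). The planner's own cluster census
(clusters_m10_14.md on stmt-2640): every pair with BC ≥ 0.8 at m ≤ 14 is an adjacent twin c·2^b ∓ 1
(block sign flip k(c2^b ∓ 1) =
ck·2^b ∓ k; at most one partner per r, no chains), and the strongest non-adjacent pairs share a
sparse lcm (divisors {65,91,105,117} of
2^12 − 1, BC .66–.79). Hence the REPAIRED A = LIST identification (poly(m) candidates ∋ r; for
factoring a list is as good as a point:
r = least candidate with a^r ≡ 1 mod N) and the REPAIRED B = an FP list decoder (B ⇒ A by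
substitution, kernel-checked). Second
correction (refuter C, grounder): with idle S wires (S = T² ∈ iqpDiag) and a redundant exponent, ONE
commuting layer with ONE query reads
both quadratures and period finding is KNOWN (non-adaptive Kitaev phase estimation,
KitaevShenVyalyi2002 §13.5, HoyerSpalek2005; tree
PeriodFindingDecode; simulated P[r] ≈ .996 at m = 20/30/40). So "can one commuting layer find
periods, black-box?" is settled YES; A/B now
isolate the single-quadrature (Hadamard-only) reading — a statistical/computational question about
Shor's own coset state, informative
for the persistence×refresh calculus but OFF the deciding theorem, whose hypotheses are
CommutingDecidersInBQP and CommutingWitness only.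
The white-box obstruction stands untouched: no P-computable phase oracle sits inside a commuting
layer without clean ancillas.
RANKED CRUXES. (2) HadamardCosetSamplesIdentifyPeriod (REPAIRED, list form): polynomials p, q and
per-m decoders mapping p(m) samples
of L_{m,r} to ≤ q(m) candidates containing every odd r ∈ [2^{⌊m/2⌋−1}, 2^{⌊m/2⌋}) w.p. ≥ 2/3; proof
route = CLUSTER BOUND (#{r' :
BC(L_r,L_{r'}) > 1 − 1/t(m)} < q(m)) + clique decoder over pairwise likelihood-ratio tests (miss
probability ≤ 2^{m/2}(1 − 1/t)^n);
refutation = m^{ω(1)} mutually 1/poly-confusable periods (sparse-lcm divisor clusters are the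
candidates). (4) WeightCharacterSignHard
(S-side, hypothesis-type, the ONLY item carrying the thesis to the target): an explicit FP family of
{Z,CZ,T} circuits whose Z4-weight
statistic Re E[i^{|w|}] has promise gap 1/3 and whose sign language is outside BPP; it is the exact
residue of a white-box BC26
instantiation (F2-verdicts are classical, i^{|w|} is the first non-classical character) and equals
Re⟨0|H D† H S^{⊗W} H D H|0⟩, a
T-depth-2 amplitude computable in 2^{O(t)} for T-count t — so witnesses need t = ω(log n), the same
ladder as route Dequantize.
Supports: HadamardCosetPeriodDecoder (REPAIRED B, rank 3: FP list decoder, indexed output; implies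
A), WeightCharacterGivesWitness (C → X
by tensor-power sampling + Hoeffding), CommutingDecidersInBQP (bridge). Deciding theorem: closes
(bridge, X) — proved, unchanged.
KILL CRITERIA. (i) "every one-shot commuting decider over {Z,CZ,T} decides a BPP language" proved
(per-verdict dequantization, e.g. norm
estimation with polynomial stabilizer extent of S^{⊗W} between IQP layers) ⟹ close refuted, file
"IQP is decision-useless white-box" as
negative knowledge; (ii) C's statistic Re E[i^{|w|}] shown BPP-estimable to ±1/6 for FP-uniform
{Z,CZ,T} families ⟹ C refuted,
no typed path to X remains ⟹ close exhausted (A/B, true or false, do not rescue the line: their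
black-box positive form is Kitaev's and
known, their white-box transfer is blocked by the clean-ancilla obstruction); (iii) refutation of
the repaired A (super-polynomial
confusable clusters) is NOT a route kill — it closes the period-finding branch as negative knowledge
("the Hadamard-only reading of
Shor's coset state is information-starved") and B falls with it; (iv) B proved ⟹ no re-plan of the
assembly (see (ii)), record as a
stand-alone result.
NOT DECOMPOSED YET. Adaptive BPP^IQP (definition BPPSampIQP requested); persistence×refresh calculus
vs DQC1 (card one-clean-qubit);
Forrelation instantiations needing CCZ or iO (cards hidden-spread-forrelation,
forrelation-rigidity-depth-ladder); the formal
identification "L_{m,r} = output law of the one-query IQP^f circuit" (needs phase-oracle gates in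
QCircuit; 3-line derivation in the
docstrings); the NEGATIVE theorem ¬A_exact (complete paper proof + formalisation roadmap (a)–(f) in
EVIDENCE.md on stmt-2640: Walsh
expansion, 16×16 rational transfer matrix, contraction certificate, Le Cam) — not filed as an item
because nothing on the closes path
consumes it; the quadrature-complete idle-S decoder (known, Kitaev) — not filed; the CLUSTER BOUND
behind the repaired A is the foreseen
layer-2 child of A (split A ⇐ ClusterBound → CliqueDecoderWorks → A) once a prover asks for it.
CHEAPEST FALSIFIER. For the line: estimate Re E[i^{|w|}] = Re⟨0|H D† H S^{⊗W} H D H|0⟩ classically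
to ±1/6 for arbitrary FP-uniform
{Z,CZ,T} families (stabilizer-extent / norm-estimation of S^{⊗W} between two IQP layers,
BravyiEtAl2019; or a peaked-shallow-circuit
argument, BravyiGossetLiu2023) — success kills C and, by (ii), the route. For the repaired A: run
hclaw.py / clusters.py (both on
stmt-2640) at m = 16…24 and tabulate, per r, #{r' : 1 − BC ≤ 1/m²}; growth beyond 2, or BC → 1
inside the divisor clusters of 2^j ± 1,
predicts ¬A; a proof of ¬A needs a family of m with m^{ω(1)} mutually confusable periods (d(2^j − 1)
is m^{ω(1)} for smooth j ≤ m).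

Novelty: Nearest prior art: ShepherdBremner2009 (defines BPP^IQP with non-adaptive parallel calls, asks for a
non-BPP language, §4.2 remarks on Simon/Shor and Høyer–Špalek constant depth); BuzetChailloux2026 =
arXiv:2604.15248 (the relativized route: single-query IQP circuit for signed 2-Forrelation,
(BPP^IQP)^O ⊄ PH^O non-adaptively, |F| = Ω(2^n)); BremnerMontanaroShepherd2017 §3.1 = tree
cubeFourierCoeff_iqpProb_eq_prod (F2-linear statistics of {Z,CZ,T}-IQP laws are classical);
BravyiGosset2016 (2^{O(t)} amplitude algorithms); Gelfond1968 / MauduitRivat2015 (digit sums along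
progressions); the card refresh-without-persistence (graded new-combination) and its sibling
xor-blind-to-multiplication. DELTA: (1) the ONE-SHOT commuting-decider class with a typed thesis
over existing tree declarations (no oracle machine), lossless because all known IQP decision
algorithms are non-adaptive and coins are free (S on an idle wire); (2) a computed phenomenon found
in no searched source and contrary to the card's and its auditor's expectation: the
Hadamard-measured Z-coset law L_{m,r} (Shor with QFT → H^{⊗m}) identifies the period at m ≤ 14 (TV
0.55–0.79, ML exact from 16 samples), turning "can commuting circuits factor?" into the
statistical/computational pair A (identifiability as m → ∞) / B (FP decoder); (3) the Z4-weight
statistic Re E[i^{|w|}] as the exact white-box residue of BC26 over {Z,CZ,T} (parities are classical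
by the derivative trick, i^{|w|} is the first non-classical character) in  [refs: 2604.15248, 0809.0847, 2604.27457, ShepherdBremner2009, BuzetChailloux2026, BremnerMontanaroShepherd2017, BravyiGosset2016, Gelfond1968, MauduitRivat2015, AroraBarak2009]

Barriers (technique_class: commuting-circuits; black-box; class-separation): technique_class: commuting-circuits; black-box; class-separation
- Literature.Barriers.QuantumAdvantage.SeparationPrerequisites: APPLIES to the target
CommutingWitness (it implies the summit, hence PP ⊄ BPP, P ≠ PP, P ≠ P^#P, P ≠ PSPACE); NOT evaded —
X is reached only through the hypothesis-type crux WeightCharacterSignHard (or a future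
decoder-based witness); the unconditional content of the route is cruxes A/B (theorems about an
explicit law) and the two supports.
- Literature.Barriers.QuantumAdvantage.Relativization: X relativizes TRUE ((one-shot IQP deciders)^O
⊄ PH^O ⊇ BPP^O by BuzetChailloux2026 Thm 3, non-adaptive ⟹ one-shot) and FALSE (PSPACE oracle), so
neither X nor ¬X has a relativizing proof; acknowledged: crux C is white-box by construction
(explicit {Z,CZ,T} families, verdict i^{|w|}), and kill criterion (i) asks for per-verdict,
non-black-box dequantization. Cruxes A/B are statements about one explicit probability law (no
oracle in the statement); their black-box READING ("commuting circuits see/find periods given a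
phase oracle") is where relativized reasoning is the appropriate tool, and the rationale records why
the white-box transfer is a separate crux (no P-computable phase oracle fits inside a commuting
layer without clean ancillas).
- Literature.Barriers.QuantumAdvantage.Algebrization: same status as Relativization for X/¬X (IQP^Ã
with low-degree extension oracles changes nothing in BC26's argument or in the PSPACE collapse); the
route does not arithmet

History (route lifecycle, newest last):
- 2026-08-15T21:48:29Z · rev 5: restated HadamardCosetSamplesIdentifyPeriod (stmt-QuantumAdvantage-2640) — repair: HadamardCosetSamplesIdentifyPeriod refuted-misstated (refuter-rattack-stmt-QuantumAdvantage-2640-0, EVIDENCE.md: twin periods 3·2^a∓1, TV ≤ C·0.9743^a, (planner-rrefute-QuantumAdvantage-CommutingDeci-03071ad3-0)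
- 2026-08-15T21:49:46Z · rev 6: restated HadamardCosetPeriodDecoder (stmt-QuantumAdvantage-2641) — repair (same witness): HadamardCosetPeriodDecoder (support B, stmt-QuantumAdvantage-2641) is refuted as typed together with A's exact form (an FP exact decoder (planner-rrefute-QuantumAdvantage-CommutingDeci-03071ad3-0)
- 2026-08-16T04:14:51Z · AUTO-CRUX (backfill): CommutingWitness — hypotheses of the deciding theorem that nothing in the route derives are cruxes (operator:999:1085951)
- 2026-08-26T12:42:25Z · DORMANT — reconciler: no traction for 7.1 d (last activity item-proof-filed at 2026-08-19T10:05:29Z); parked, not closed — `ledger route dormant route-QuantumAdvantage-Co (operator:999:2685154)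

sub-problem: QuantumAdvantage · status: dormant · opened planner-plancard-QuantumAdvantage-QuantumAdva-863ca303-0 2026-08-15T11:06:34Z · rev 6 · ledger route-QuantumAdvantage-CommutingDeciders
GENERATED by the gate from the ledger (D-0016/17). Provers cite these decls: `theorem foo : Summit.QuantumAdvantage.QuantumAdvantage.Theses.CommutingDeciders.<Decl> := …` in Summits/QuantumAdvantage/QuantumAdvantage/Theorems/<Name>.lean.
-/

namespace Summit.QuantumAdvantage.QuantumAdvantage.Theses.CommutingDeciders

open scoped BigOperators Topology Manifold Classical MeasureTheory ProbabilityTheory Matrix InnerProductSpace ComplexConjugate ContinuousMap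
open Filter Set Function TopologicalSpace MeasureTheory

attribute [summit_statement] _root_.QuantumAdvantage

open Literature.QuantumAdvantage

/-- item stmt-QuantumAdvantage-2639 · crux (kind.auto-crux: conjecture-grade) · rank 0 · open · by planner
why it might fail: ¬X is live: every one-shot {Z,CZ,T} decider may decide only BPP languages — F2-linear verdicts are exactly classical (cubeFourierCoeff_iqpProb_eq_prod), no non-BPP language in BPP^IQP is known white-box (ShepherdBremner2009 p.4), X is reached only via hypothesis-type C, and X ⇒ summit ⇒ PP ⊄ BPP.
sources: ShepherdBremner2009, BuzetChailloux2026, BremnerJozsaShepherd2011, BravyiGosset2016, Literature.Barriers.QuantumAdvantage.SeparationPrerequisites, Literature.Barriers.QuantumAdvantage.UncorrectedNoiseIQP.cubeFourierCoeff_iqpProb_eq_prod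
[target] X: some L ∉ BPP has a ONE-SHOT COMMUTING DECIDER over iqpDiag = {Z,CZ,T}: poly-time x ↦ D_x
(W_x wires, sigmaEncode-uniform), one run of H^{⊗W} D_x H^{⊗W} on |0^W⟩, all wires measured, verdict
boolPair x (ofFn w) ∈ A with A ∈ P, error ≤ 1/3. X ⟹ ¬(BPP^IQP ⊆ BPP) ⟹ summit; lossless vs the
card's X₂ for everything in print (BuzetChailloux2026 Thms 1–3 are non-adaptive; k parallel calls =
1 call on disjoint registers; coins = idle wire with S). Why it might fail: every such decider might
decide a BPP language (per-verdict dequantization: F2-linear verdicts are classical by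
cubeFourierCoeff_iqpProb_eq_prod; the open cases are verdicts of exponential Fourier l1-mass).
Hypothesis-type: reached via WeightCharacterSignHard + WeightCharacterGivesWitness. -/
@[route_item "route-QuantumAdvantage-CommutingDeciders", crux]
def CommutingWitness : Prop :=
  open Literature.Computability.Cryptography Literature.Computability.Complexity in ∃ L : Language Bool, L ∉ BPP ∧ ∃ (W : List Bool → ℕ) (D : (x : List Bool) → QCircuit iqpDiag (W x)) (A : Language Bool), A ∈ Classes.P ∧ PolyTimeComputable (id : List Bool → List Bool) (QCircuit.sigmaEncode (G := iqpDiag)) (fun x => (⟨W x, 0, D x⟩ : Σ n m : ℕ, QCircuit iqpDiag (n + m))) ∧ ∀ x : List Bool, (x ∈ L → (2 / 3 : ℝ) ≤ ∑ w : QReg (W x), (if boolPair x (List.ofFn w) ∈ A then ‖(iqpUnitary (D x) *ᵥ basisState (fun _ => false)) w‖ ^ 2 else 0)) ∧ (x ∉ L → ∑ w : QReg (W x), (if boolPair x (List.ofFn w) ∈ A then ‖(iqpUnitary (D x) *ᵥ basisState (fun _ => false)) w‖ ^ 2 else 0) ≤ (1 / 3 : ℝ))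

-- earlier HadamardCosetSamplesIdentifyPeriod (stmt-QuantumAdvantage-2640, replaced 2026-08-15T21:48:29Z -> stmt-QuantumAdvantage-14182): retired by None — ∃ p : Polynomial ℕ, ∀ m : ℕ, ∃ Dec : (Fin (p.eval m) → (Fin m → Bool)) → ℕ, ∀ r : ℕ, Odd r → 2 ^ (m / 2 - 1) ≤ r → r < 2 ^ (m / 2) → (2 / 3 : ℝ) ≤ ∑ us : Fin (p.eval m) → (Fin m → Bool), (∏ t, (((2 : ℝ) ^ m)⁻¹ ^ 2 * ∑ c₀ ∈ Finset.range r, (∑ c ∈ (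
/-- item stmt-QuantumAdvantage-14182 · crux · rank 2 · open · by planner
why it might fail: Needs poly-size confusable clusters: fails if some family of m has m^{ω(1)} periods pairwise at 1−BC(L_r,L_r') ≤ 1/poly(m). Candidates: divisor clusters of sparse X (2^j±1: d(2^j−1) is m^{ω(1)} for smooth j; lcm 2^8+2^7+1-type), whose BC rises .70→.81 over m = 10..16.
sources: KitaevShenVyalyi2002, Shor1997, HoyerSpalek2005, Gelfond1968, MauduitRivat2015, evidence:stmt-QuantumAdvantage-2640/EVIDENCE.md (exact form refuted: twins 3·2^a∓1, TV ≤ C·0.9743^a; repaired statement C'1 = this)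
[crux A, rank 2 — REPAIRED 2026-08-15 to the LIST form (refuter's C'1). The exact-identification
form filed at open is refuted-misstated: the twin periods r∓ = 3·2^a ∓ 1 (m = 2a+4) have TV(L_{r−},
L_{r+}) ≤ C·0.9743^a (paper proof, EVIDENCE.md on this item; numerically 1 − BC = 0.50·2^{−a/2} to m
= 23), so by Le Cam no poly(m)-sample decoder names r itself.] L_{m,r}(u) := 4^{-m} Σ_{c₀<r}
|Σ_{c<2^m, c≡c₀ (r)} (-1)^{⟨u, bits c⟩}|² is the output law of Shor's circuit with the QFT replaced
by H^{⊗m} (one standard phase-oracle query inside an IQP sandwich; Fourier side P_r(s) = Pr_ε[r |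
Σ_{i∈s} ε_i 2^i], ε uniform ±1). CLAIM: there are polynomials p, q and, for each m, a decoder taking
p(m) i.i.d. samples to a list of ≤ q(m) naturals that contains r with probability ≥ 2/3, for every
odd r ∈ [2^{⌊m/2⌋−1}, 2^{⌊m/2⌋}) (Shor's regime N ∈ (r², 4r²]). For factoring a list is as good as a
point (r = least candidate with a^r ≡ 1 mod N); equivalent up to routine amplification to point
decoding with success ≥ 1/poly(m). PROOF ROUTE: (1) CLUSTER BOUND — polynomials t, q with #{r' :
BC(L_r, L_{r'}) > 1 − 1/t(m)} < q(m) for every r (pairwise affinities from second moments of Σ_j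
γ_u(jr), γ_u = produ -/
@[route_item "route-QuantumAdvantage-CommutingDeciders"]
def HadamardCosetSamplesIdentifyPeriod : Prop :=
  ∃ p q : Polynomial ℕ, ∀ m : ℕ, ∃ Dec : (Fin (p.eval m) → (Fin m → Bool)) → Finset ℕ, (∀ us, (Dec us).card ≤ q.eval m) ∧ ∀ r : ℕ, Odd r → 2 ^ (m / 2 - 1) ≤ r → r < 2 ^ (m / 2) → (2 / 3 : ℝ) ≤ ∑ us : Fin (p.eval m) → (Fin m → Bool), (∏ t, (((2 : ℝ) ^ m)⁻¹ ^ 2 * ∑ c₀ ∈ Finset.range r, (∑ c ∈ (Finset.range (2 ^ m)).filter (fun c => c % r = c₀), (-1 : ℝ) ^ (Finset.univ.filter (fun i : Fin m => (us t) i = true ∧ Nat.testBit c i.val = true)).card) ^ 2)) * (if r ∈ Dec us then 1 else 0)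

/-- item stmt-QuantumAdvantage-17826 · crux · rank 2 · open · by planner
[crux] [X1 of the split CommutingWitness <= X1 /\ X2; PROMISE WITNESS] Some PROMISE problem Q
outside textbook promise-BPP (PromiseBPP', 2/3-gap asked on the promise only) has a ONE-SHOT
COMMUTING DECIDER over iqpDiag = {Z,CZ,T}: sigma-uniform poly-time x |-> D_x, one run of H^W D_x H^W
on |0^W>, all wires measured, verdict boolPair x (ofFn w) in A with A in P, accepting Q.yes with
prob >= 2/3 and Q.no with prob <= 1/3 (nothing asked off the promise). Strictly WEAKER than
CommutingWitness (X -> X1: a language is the promise problem ofLanguage L, tree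
ofLanguage_mem_PromiseBPP'_iff) and NOT known to give the summit (promise-vs-language seam; the
BQP-level lift does not relativize: Literature.Barriers.QuantumAdvantage.PromiseLiftRelativization).
It is the level at which ALL evidence for commuting-circuit decision power lives: relativized,
single-query IQP circuits decide signed 2-Forrelation outside PH (BuzetChailloux2026 Thms 1-3);
white-box, the first non-classical statistic of a {Z,CZ,T} law, the Z4 weight character E[i^{|w|}] =
<0|H^n D^+ H^n S^n H^n D H^n|0>, is EXACTLY a graph-based forrelation of
Bravyi-Gosset-Grier-Schaeffer 2021 (f = phase function of D, g = conj f, O_j = HS -/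
@[route_item "route-QuantumAdvantage-CommutingDeciders"]
def CommutingPromiseWitness : Prop :=
  open Literature.Computability.Cryptography Literature.Computability.Complexity in ∃ Q : PromiseProblem, Q ∉ PromiseBPP' ∧ ∃ (W : List Bool → ℕ) (D : (x : List Bool) → QCircuit iqpDiag (W x)) (A : Language Bool), A ∈ Classes.P ∧ PolyTimeComputable (id : List Bool → List Bool) (QCircuit.sigmaEncode (G := iqpDiag)) (fun x => (⟨W x, 0, D x⟩ : Σ n m : ℕ, QCircuit iqpDiag (n + m))) ∧ (∀ x ∈ Q.yes, (2 / 3 : ℝ) ≤ ∑ w : QReg (W x), (if boolPair x (List.ofFn w) ∈ A then ‖(iqpUnitary (D x) *ᵥ basisState (fun _ => false)) w‖ ^ 2 else 0)) ∧ (∀ x ∈ Q.no, ∑ w : QReg (W x), (if boolPair x (List.ofFn w) ∈ A then ‖(iqpUnitary (D x) *ᵥ basisState (fun _ => false)) w‖ ^ 2 else 0) ≤ (1 / 3 : ℝ))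

/-- item stmt-QuantumAdvantage-2642 · crux · rank 4 · open · by planner
why it might fail: Summit-strength ∃-claim, no candidate known: |s(x)| ≥ 1/3 ∀x, s = Re⟨+|D_x†(HSH)^{⊗W}D_x|+⟩, needs T-count ω(log n) (else exact in 2^{O(t)}·poly, BravyiGosset2016; Clifford: Gauss sum) yet cat-like weight concentration that stabilizer-rank norm estimation (BravyiEtAl2019) may exploit ⇒ sign ∈ BPP.
sources: BravyiGosset2016, BravyiEtAl2019, AaronsonGottesman2004, BuzetChailloux2026, BremnerMontanaroShepherd2017, AaronsonAmbainis2014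
[crux C, rank 4 — S-side, hypothesis-type] There is an FP-uniform family x ↦ D_x of {Z,CZ,T}
circuits (W_x wires) whose Z4-weight statistic s(x) := Re Σ_w |⟨w|H D_x H|0⟩|² · i^{|w|} satisfies
the total promise |s(x)| ≥ 1/3 for all x, and whose sign language {x : s(x) > 0} is not in BPP. This
is the exact white-box residue of BuzetChailloux2026: their accepting set F = {0}×T ∪ {1}×T̄ has
indicator (1 + (-1)^b σ̂(x))/2 with σ̂(x) = √2 sin(π(n-2|x|)/4), the imaginary part of a Z4 product
character, and for {Z,CZ,T} phases every F2-character statistic E(-1)^{s·w} = E_x e^{i(φ(x⊕s)-φ(x))}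
is classical (the derivative of a degree-2 phase is linear; tree cubeFourierCoeff_iqpProb_eq_prod),
while E[i^{|w|}] = ⟨0|H D† H S^{⊗W} H D H|0⟩ = 2^{-W/2} Σ_s i^{|s|} Γ_D(s) is a T-depth-2 Clifford+T
amplitude: in BQP trivially, computable in 2^{O(t)}·poly for T-count t (so witnesses need t = ω(log
n), cf. route Dequantize's T-count ladder), classical status open. With support
WeightCharacterGivesWitness it yields X. -/
@[route_item "route-QuantumAdvantage-CommutingDeciders"]
def WeightCharacterSignHard : Prop :=
  open Literature.Computability.Cryptography Literature.Computability.Complexity in ∃ (W : List Bool → ℕ) (D : (x : List Bool) → QCircuit iqpDiag (W x)), PolyTimeComputable (id : List Bool → List Bool) (QCircuit.sigmaEncode (G := iqpDiag)) (fun x => (⟨W x, 0, D x⟩ : Σ n m : ℕ, QCircuit iqpDiag (n + m))) ∧ (∀ x : List Bool, (1 / 3 : ℝ) ≤ |(∑ w : QReg (W x), ((‖(iqpUnitary (D x) *ᵥ basisState (fun _ => false)) w‖ ^ 2 : ℝ) : ℂ) * Complex.I ^ (Finset.univ.filter (fun i : Fin (W x) => w i = true)).card).re|) ∧ {x : List Bool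 | 0 < (∑ w : QReg (W x), ((‖(iqpUnitary (D x) *ᵥ basisState (fun _ => false)) w‖ ^ 2 : ℝ) : ℂ) * Complex.I ^ (Finset.univ.filter (fun i : Fin (W x) => w i = true)).card).re} ∉ BPP

-- earlier HadamardCosetPeriodDecoder (stmt-QuantumAdvantage-2641, replaced 2026-08-15T21:49:46Z -> stmt-QuantumAdvantage-14197): retired by None — open Literature.Computability.Cryptography Literature.Computability.Complexity in ∃ Dec ∈ FP, ∃ p : Polynomial ℕ, ∀ m : ℕ, ∀ r : ℕ, Odd r → 2 ^ (m / 2 - 1) ≤ r → r < 2 ^ (m / 2) → (2 / 3 : ℝ) ≤ ∑ us : Fin (p.eval m) → (Fin m → Bool), (∏ t, (((2 : ℝ) ^ m)⁻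
/-- item stmt-QuantumAdvantage-14197 · support · rank 3 · open · by planner
why it might fail: B ⇒ A by substitution, so B inherits A's confusable-cluster risk; independently, efficient list decoding may fail where information suffices (a likelihood costs 2^{m/2}·m; detecting a planted sparse multiple of r may reduce to it); the natural idle-S two-quadrature form is Kitaev's — known.
sources: KitaevShenVyalyi2002, HoyerSpalek2005, Shor1997, Kitaev1995, ShepherdBremner2009, evidence:stmt-QuantumAdvantage-2640/EVIDENCE.md (exact forms of A and B refuted by the twin periods; list repair)
[support B, rank 3 — REPAIRED 2026-08-15 with A to the LIST form; B ⇒ A by substitution (list =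
image of the index set; kernel-checked in the planner's Sketch.lean); the exact single-answer FP
form falls with A's exact form (twin periods 3·2^a ∓ 1, EVIDENCE.md on stmt-QuantumAdvantage-2640).]
'Commuting Shor', Hadamard-only reading, black-box form: an FP function Dec and polynomials p, q
such that for all m and all odd r ∈ [2^{⌊m/2⌋−1}, 2^{⌊m/2⌋}), from p(m) i.i.d. samples of L_{m,r}
the candidates decodeNat (Dec ⟨1^m, ⟨1^i, concatenated masks⟩⟩), i < q(m), contain r with
probability ≥ 2/3 (each candidate is classically checkable via a^r ≡ 1 mod N). CONTEXT: with idle S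
wires (S = T² ∈ iqpDiag) and a redundant exponent one commuting layer with one query reads both
quadratures and the efficient decoder is KNOWN (non-adaptive Kitaev phase estimation:
KitaevShenVyalyi2002 §13.5, HoyerSpalek2005; tree PeriodFindingDecode; refuter simulation P[r] ≈
.996 at m = 20/30/40) — so the open content here is purely computational: efficient list decoding
from the single-quadrature law (brute-force ML costs 2^{m/2}·m per likelihood). Candidate decoders:
carry-pattern statistics of anomalous masks, -/
@[route_item "route-QuantumAdvantage-CommutingDeciders"]
def HadamardCosetPeriodDecoder : Prop :=
  open Literature.Computability.Cryptography Literature.Computability.Complexity in ∃ Dec ∈ FP, ∃ p q : Polynomial ℕ, ∀ m : ℕ, ∀ r : ℕ, Odd r → 2 ^ (m / 2 - 1) ≤ r → r < 2 ^ (m / 2) → (2 / 3 : ℝ) ≤ ∑ us : Fin (p.eval m) → (Fin m → Bool), (∏ t, (((2 : ℝ) ^ m)⁻¹ ^ 2 * ∑ c₀ ∈ Finset.range r, (∑ c ∈ (Finset.range (2 ^ m)).filter (fun c => c % r = c₀), (-1 : ℝ) ^ (Finset.univ.filter (fun i : Fin m => (us t) i = true ∧ Nat.testBit c i.val = true)).card)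 ^ 2)) * (if (∃ i < q.eval m, Computability.decodeNat (Dec (boolPair (Computability.unaryEncodeNat m) (boolPair (Computability.unaryEncodeNat i) (List.ofFn fun t => List.ofFn (us t)).flatten))) = r) then 1 else 0)

/-- item stmt-QuantumAdvantage-17827 · support · rank 3 · open · by planner
[crux] [X2 of the split CommutingWitness <= X1 /\ X2; PROMISE->LANGUAGE LIFT for commuting deciders]
If every LANGUAGE with a one-shot commuting decider (total 2/3-vs-1/3 gap, the inlined predicate of
CommutingWitness) is in BPP, then every PROMISE problem with a one-shot commuting promise-decider
(gap on Q.yes/Q.no only) is in PromiseBPP'. Logically X2 <-> (X1 -> X): the split is the bridge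
split T /\ (T -> X) with T = X1 substantive (open) and not giving the summit alone; the factoring is
EXACT (X <-> X1 /\ X2, kernel-checked: CommutingWitness_of_subs / _iff_subs). X2 is the IQP-level
instance of the open promise lift 'BQP <= BPP -> PromiseBQP <= PromiseBPP'' (route PromiseLift's
PlLift, stmt-0250; classical analogue BPP = P ->? prBPP = prP, Goldreich2011 Sec. 6 fn 27;
AaronsonArkhipovToC2013 Sec. 10 (9)-(10): promise advantage without language advantage is 'entirely
possible'); the general lift admits no relativizing proof (tree: PromiseLiftRelativization). Its one
known non-vacuous road is the hardness-free TOTALIZATION C+ (registered line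
Cruxes/CommutingWitness/Lines/totalize.lean, stub_totalize): every promise problem with a one-shot
commuting promise-decider is separated by -/
@[route_item "route-QuantumAdvantage-CommutingDeciders"]
def CommutingPromiseLift : Prop :=
  open Literature.Computability.Cryptography Literature.Computability.Complexity in (∀ L : Language Bool, (∃ (W : List Bool → ℕ) (D : (x : List Bool) → QCircuit iqpDiag (W x)) (A : Language Bool), A ∈ Classes.P ∧ PolyTimeComputable (id : List Bool → List Bool) (QCircuit.sigmaEncode (G := iqpDiag)) (fun x => (⟨W x, 0, D x⟩ : Σ n m : ℕ, QCircuit iqpDiag (n + m))) ∧ ∀ x : List Bool, (x ∈ L → (2 / 3 : ℝ) ≤ ∑ w : QReg (W x), (if boolPair x (List.ofFn w) ∈ A then ‖(iqpUnitary (D x) *ᵥ basisState (fun _ => false)) w‖ ^ 2 else 0)) ∧ (x ∉ L → ∑ w : QReg (W x), (if boolPair x (List.ofFn w) ∈ A then ‖(iqpUnitary (D x) *ᵥ basisState (fun _ => false)) w‖ ^ 2 else 0) ≤ (1 / 3 : ℝ))) → L ∈ BPP) → ∀ Q : PromiseProblem, (∃ (W : List Bool → ℕ) (D : (x : List Bool)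 → QCircuit iqpDiag (W x)) (A : Language Bool), A ∈ Classes.P ∧ PolyTimeComputable (id : List Bool → List Bool) (QCircuit.sigmaEncode (G := iqpDiag)) (fun x => (⟨W x, 0, D x⟩ : Σ n m : ℕ, QCircuit iqpDiag (n + m))) ∧ (∀ x ∈ Q.yes, (2 / 3 : ℝ) ≤ ∑ w : QReg (W x), (if boolPair x (List.ofFn w) ∈ A then ‖(iqpUnitary (D x) *ᵥ basisState (fun _ => false)) w‖ ^ 2 else 0)) ∧ (∀ x ∈ Q.no, ∑ w : QReg (W x), (if boolPair x (List.ofFn w) ∈ A then ‖(iqpUnitary (D x) *ᵥ basisState (fun _ => false)) w‖ ^ 2 else 0) ≤ (1 / 3 : ℝ))) → Q ∈ PromiseBPP'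

/-- item stmt-QuantumAdvantage-17831 · support · rank 9 · open · by planner
[support] GLUE of the strategist split CommutingWitness ⟸ CommutingPromiseWitness ∧
CommutingPromiseLift (crux-strategist cstrat-stmt-QuantumAdvantage-2639-r1; the route-level `route
edit --split CommutingWitness --into children.json` is staged for the final cycle / tenure planner /
operator — it bounced for this seat under the final-cycle rule — see
Cruxes/CommutingWitness/DECOMPOSITION.md §5; with this item proved, CommutingWitness is DERIVED from
the two children and the deciding theorem `closes (hB : CommutingDecidersInBQP) (hX :
CommutingWitness)` is unchanged). PROVABLE NOW — kernel-checked as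
Summit.QuantumAdvantage.QuantumAdvantage.Theses.CommutingDeciders.CommutingWitness_of_subs in
Cruxes/CommutingWitness/SplitSketch.lean (rc 0, 0 sorry) and, Theorems-ready with the children
inlined as hypotheses, as
Summit.QuantumAdvantage.QuantumAdvantage.Theorems.commutingWitness_of_promiseWitness_of_promiseLift
in Cruxes/CommutingWitness/SplitGlueProof.lean (rc 0, 0 sorry; attached as evidence on
stmt-QuantumAdvantage-2639). Proof (contraposition, logic only — trivial_seam by design, the content
is in the two children): intro h₁ h₂; by_contra hX; obtain ⟨Q, hQ, hdec⟩ := h₁; refine hQ -/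
@[route_item "route-QuantumAdvantage-CommutingDeciders"]
def CommutingWitnessOfSubs : Prop :=
  CommutingPromiseWitness → CommutingPromiseLift → CommutingWitness

/-- item stmt-QuantumAdvantage-2643 · support · rank 9 · open · by planner
sources: BuzetChailloux2026, BremnerJozsaShepherd2011
[support, glue C → X; provable] From the family of WeightCharacterSignHard build a one-shot
commuting decider for its sign language: one IQP circuit made of k = 40 disjoint copies of D_x
(juxtaposition: H^{⊗kW}(D_x ⊗ … ⊗ D_x)H^{⊗kW}, output law = product law), verdict [ (1/k) Σ_t
cos(π|w_t|/2) > 0 ] ∈ P; Hoeffding with promise gap 1/3 gives error ≤ 1/3; uniformity of x ↦ ⟨kW_x,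
0, D_x^{⊗k}⟩ follows from that of D_x. Needs: juxtaposition of QCircuits on disjoint wire blocks and
'iqpUnitary of a juxtaposition = Kronecker product' (cf. the tree's PolyCopies*/MultiCopy files),
Hoeffding for bounded i.i.d. reals (Mathlib). -/
@[route_item "route-QuantumAdvantage-CommutingDeciders"]
def WeightCharacterGivesWitness : Prop :=
  WeightCharacterSignHard → CommutingWitness

/-- item stmt-QuantumAdvantage-2644 · support · rank 9 · open · by planner
sources: BernsteinVazirani1997, BremnerJozsaShepherd2011, NielsenChuang2010
[support, the bridge of the Assembly; known, formalisation work] Every language with a one-shot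
commuting decider (same inlined predicate as in CommutingWitness) is in BQP = BQPOver cliffordT: H
and T are native, Z = S·S, CZ = (1⊗H)·CNOT·(1⊗H); the input-dependent generator x ↦ D_x (poly-time,
sigmaEncode output) is compiled into a length-uniform Clifford+T family reading |x⟩ (the standard
'polynomial-time generated = uniform' robustness of BQP, Nishimura–Ozawa / Watrous §III), and the P
verdict A is computed reversibly (Toffoli is exactly Clifford+T; clean ancillas are available in
BQP) onto output wire 0; error 1/3 is kept. Tree infrastructure: ClassicalWrap*/CWrap*, RevSLP*,
ReversibleCliffordT, BQPSubroutine. -/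
@[route_item "route-QuantumAdvantage-CommutingDeciders", crux]
def CommutingDecidersInBQP : Prop :=
  open Literature.Computability.Cryptography Literature.Computability.Complexity in ∀ L : Language Bool, (∃ (W : List Bool → ℕ) (D : (x : List Bool) → QCircuit iqpDiag (W x)) (A : Language Bool), A ∈ Classes.P ∧ PolyTimeComputable (id : List Bool → List Bool) (QCircuit.sigmaEncode (G := iqpDiag)) (fun x => (⟨W x, 0, D x⟩ : Σ n m : ℕ, QCircuit iqpDiag (n + m))) ∧ ∀ x : List Bool, (x ∈ L → (2 / 3 : ℝ) ≤ ∑ w : QReg (W x), (if boolPair x (List.ofFn w) ∈ A then ‖(iqpUnitary (D x) *ᵥ basisState (fun _ => false)) w‖ ^ 2 else 0)) ∧ (x ∉ L → ∑ w : QReg (W x), (if boolPair x (List.ofFn w) ∈ A then ‖(iqpUnitary (D x) *ᵥ basisState (fun _ => false)) w‖ ^ 2 else 0) ≤ (1 / 3 : ℝ))) → L ∈ BQP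

/-- item stmt-QuantumAdvantage-2645 · assembly · rank 1 · closed · proved by Summit.QuantumAdvantage.QuantumAdvantage.Theorems.CommutingDeciders.Assembly_proof @ 27fc3325a297 (prover) · by planner
sources: BernsteinVazirani1997
[assembly] CommutingDecidersInBQP → CommutingWitness → QuantumAdvantage: unfold QuantumAdvantage = ∃
L, L ∈ BQP ∧ L ∉ BPP; take the witness L of CommutingWitness and apply the bridge to its decider.
One line of logic; all content is in the two hypotheses. -/
@[route_item "route-QuantumAdvantage-CommutingDeciders"]
def Assembly : Prop :=
  CommutingDecidersInBQP → CommutingWitness → QuantumAdvantage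

-- `Assembly` holds: proved by `Summit.QuantumAdvantage.QuantumAdvantage.Theorems.CommutingDeciders.Assembly_proof` @ 27fc3325a297 (its module imports this route file, so no `_holds` link can be stated here).

/-! D-0027 §2.1 — DECIDING THEOREM (planner-authored via `route open/edit --closes-file`; by planner-rbadge-QuantumAdvantage-CommutingDecid-84a9c107-g4-0 2026-08-15T16:09:45Z):
its hypotheses are this route's items and its conclusion the sub-problem Statement (glue_lint), and it elaborates with this file. -/

@[closes "route-QuantumAdvantage-CommutingDeciders"] theorem closes (hB : CommutingDecidersInBQP) (hX : CommutingWitness) : _root_.QuantumAdvantage := by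
  obtain ⟨L, hL, hdec⟩ := hX
  exact ⟨L, hB L hdec, hL⟩

end Summit.QuantumAdvantage.QuantumAdvantage.Theses.CommutingDeciders
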